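import Summits.CriticalPhenomena.Ising3D.Control2DOpeTail
import Mathlib.Analysis.Normed.Ring.InfiniteSum
import Mathlib.Data.Nat.Choose.Sum
import Mathlib.Algebra.BigOperators.NatAntidiagonal
import Mathlib.Tactic.Linarith
import Mathlib.Tactic.Positivity
import Mathlib.Tactic.FieldSimp
import Mathlib.Tactic.Ring
import Mathlib.Tactic.LinearCombination
import HarnessLib

/-!
# Kind `ope2eps`, sense LOWER: a `Δ`-uniform tail majorant for the SCALAR block on the `ε` box under the table functional at `(1/2,1/2)`
(cell `pub-ising3x`, seat controls-1 gen 21; KERNEL PATH for the 2D γ-certificates, kind `ope2eps` (the `λ²_σσε` datum), analytic half — CONTROL-ONLY)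

HONEST FRAMING: lottery ticket; floor = tightest certified 3D Ising CFT bounds; no exact-solution
claim without a proof. CONTROL-ONLY (`d = 2`, axiom set `A2D′`); nothing numerical is asserted here.

`Control2DOpeEpsTwoSided` (controls-1 g13) typed the lane's fourth datum: `OpeEpsLowerA2D` (`P̃ < W`, the `λ²` LOWER edge) follows
from the obligations record plus a uniform NEGATIVE sign margin `2^Δ φ[F_-[g_{Δ,0}]] ≤ -σ` on the `ε` box (`opeEpsLower_taylor`). A kernel
replay only sees the TRUNCATED block `Q_N(Δ,0)`, which under-estimates `g_{Δ,0}` — so, exactly as for kind `ope2` (`Control2DOpeTail`),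
the negative sign needs an explicit MAJORANT of the dropped double `z`-series tail, here UNIFORM in `Δ` over the box. This file proves it
for `φ = taylorFunctional2D (1/2) S w` (`0 ≤ s ≤ 1`, table indices `≤ Λ`, `0 ≤ Δ ≤ 2`, `Λ < N + 3`):
  `φ[F_-[g_{Δ,0}]] ≤ φ[F_-[Q_N(Δ,0)]] + (1/2)^{2s} (1/2)^Δ · 2W · σ_N (2 S_N + σ_N)`,
  `S_N = Σ_{m<N} 2^{-m} C(m+Λ+2, Λ)`, `σ_N = 4 · tailMajor Λ (N+2)` (`phi_block0_le_QN_add_tail`; the factor `(1/2)^Δ` is what makes the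
bound uniform after the readers' weight `2^Δ`). Ingredients (elementary): `a_m(h) ≤ 1` for `0 ≤ h ≤ 2` (`chiralCoeff_le_one`);
`|C(α, i)| ≤ C(n+i, i)` for real `0 ≤ α ≤ n` (`abs_ring_choose_le_choose`) hence `|q¹(s, α; k)| ≤ C(n+k+1, k)` (hockey stick,
`abs_qFactor₁_le_choose`) — with `α = Δ/2 + m ≤ m + 1`: `|q_{Δ/2+m}(k)| ≤ C(m+k+2, k)`, the same sequence as in the integer case; the
pair-monomial value at `(1/2,1/2)` (`Control2DTaylorHalf`); the double tail `Σ_{(m,m') ∉ [0,N)²} t_m t_{m'} = S² - S_N² ≤ σ_N(2S_N + σ_N)` with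
`t_m = 2^{-m} C(m+Λ+2, Λ)` geometric (`tsum_tail_le_tailMajor`). The kernel form (integer `S_N`, `σ_N`, the sign check as ONE Bernstein
certificate per box cell) and the generator branch are the successor's (KP8/README §6 (iv)). PROVED; no facts, standard axioms only.
[cite: RattazziEtAl2008, §5]
-/

namespace Summit.CriticalPhenomena.Ising3D.Control2D

open Finset Set
open Literature.MathematicalPhysics.QuantumFieldTheory.ConformalBootstrap3D

/-! ### Elementary bounds -/

/-- `a_m(h) ≤ 1` for `0 ≤ h ≤ 2`: the first factor is `h/2 ≤ 1`, the others `(h+i)²/((i+1)(2h+i)) ≤ 1 ⇔ h² ≤ 2h + i`. [folklore] -/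
theorem chiralCoeff_le_one {h : ℝ} (h0 : 0 ≤ h) (h2 : h ≤ 2) (m : ℕ) : chiralCoeff h m ≤ 1 := by
  rw [chiralCoeff_eq_prod h0]
  unfold chiralProd
  refine Finset.prod_le_one (fun i _ => chiralFactor_nonneg i h0) fun i _ => ?_
  unfold chiralFactor
  split_ifs with hi
  · linarith
  · have hi1 : (1 : ℝ) ≤ i := by exact_mod_cast Nat.one_le_iff_ne_zero.mpr hi
    rw [div_le_one (by positivity)]
    nlinarith

/-- `|α(α-1)⋯(α-i+1)| ≤ C(n+i, i) · i!` for real `0 ≤ α ≤ n` (each factor `|α - j| ≤ n + j`). [folklore] -/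
theorem abs_descPochhammer_eval_le {α : ℝ} {n : ℕ} (h0 : 0 ≤ α) (hn : α ≤ n) :
    ∀ i : ℕ, |(descPochhammer ℝ i).eval α| ≤ ((n + i).choose i : ℝ) * (i.factorial : ℝ)
  | 0 => by simp
  | i + 1 => by
      rw [descPochhammer_succ_eval, abs_mul]
      have ih := abs_descPochhammer_eval_le h0 hn i
      have hfac : |α - (i : ℝ)| ≤ (n : ℝ) + i + 1 := by
        rw [abs_le]; constructor <;> linarith
      have hN := Nat.add_one_mul_choose_eq (n + i) i
      have hR : (((n + i : ℕ) : ℝ) + 1) * ((n + i).choose i : ℝ) = (((n + i + 1).choose (i + 1) : ℕ) : ℝ) * ((i : ℝ) + 1) := by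
        exact_mod_cast hN
      have key : (((n + (i + 1)).choose (i + 1) : ℕ) : ℝ) * ((i + 1).factorial : ℝ) =
          ((n + i).choose i : ℝ) * (i.factorial : ℝ) * ((n : ℝ) + i + 1) := by
        rw [Nat.factorial_succ, show n + (i + 1) = n + i + 1 by ring]
        push_cast
        push_cast at hR
        linear_combination (i.factorial : ℝ) * hR.symm
      calc |(descPochhammer ℝ i).eval α| * |α - (i : ℝ)|
          ≤ ((n + i).choose i : ℝ) * (i.factorial : ℝ) * ((n : ℝ) + i + 1) :=
            mul_le_mul ih hfac (abs_nonneg _) (by positivity)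
        _ = (((n + (i + 1)).choose (i + 1) : ℕ) : ℝ) * ((i + 1).factorial : ℝ) := key.symm

/-- `|C(α, i)| ≤ C(n+i, i)` for real `0 ≤ α ≤ n`. [folklore] -/
theorem abs_ring_choose_le_choose {α : ℝ} {n : ℕ} (h0 : 0 ≤ α) (hn : α ≤ n) (i : ℕ) :
    |Ring.choose α i| ≤ ((n + i).choose i : ℝ) := by
  have hf : (0 : ℝ) < i.factorial := by positivity
  rw [choose_eq_descPochhammer_div, abs_div, abs_of_pos hf, div_le_iff₀ hf]
  exact abs_descPochhammer_eval_le h0 hn i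

/-- `|q¹(s, α; k)| ≤ C(n+k+1, k)` for `0 ≤ s ≤ 1` and real `0 ≤ α ≤ n`
(`Σ_{i+i'=k} |C(s,i)| |C(α,i')| ≤ Σ_{i'≤k} C(n+i', i') = C(n+k+1, k)`, hockey stick). [folklore] -/
theorem abs_qFactor₁_le_choose {s : ℝ} (hs0 : 0 ≤ s) (hs1 : s ≤ 1) {α : ℝ} (h0 : 0 ≤ α) {n : ℕ} (hn : α ≤ n) (k : ℕ) :
    |qFactor₁ s α k| ≤ ((n + k + 1).choose k : ℝ) := by
  unfold qFactor₁
  refine (Finset.abs_sum_le_sum_abs _ _).trans ?_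
  calc ∑ ij ∈ antidiagonal k, |(-1 : ℝ) ^ ij.1 * Ring.choose s ij.1 * Ring.choose α ij.2|
      ≤ ∑ ij ∈ antidiagonal k, ((n + ij.2).choose ij.2 : ℝ) := by
        refine Finset.sum_le_sum fun ij _ => ?_
        rw [abs_mul, abs_mul, abs_pow, abs_neg, abs_one, one_pow, one_mul]
        exact (mul_le_mul (abs_ring_choose_le_one hs0 hs1 _) (abs_ring_choose_le_choose h0 hn _) (abs_nonneg _)
          zero_le_one).trans_eq (one_mul _)
    _ = ∑ i ∈ range (k + 1), ((i + n).choose n : ℝ) := by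
        rw [← Finset.Nat.sum_antidiagonal_swap]
        simp only [Prod.snd_swap]
        rw [Finset.Nat.sum_antidiagonal_eq_sum_range_succ (fun i _ => ((n + i).choose i : ℝ)) k]
        refine Finset.sum_congr rfl fun i _ => ?_
        rw [add_comm n i, Nat.choose_symm_add]
    _ = (((k + n + 1).choose (n + 1) : ℕ) : ℝ) := by exact_mod_cast Nat.sum_range_add_choose k n
    _ = ((n + k + 1).choose k : ℝ) := by
        rw [show k + n + 1 = (n + 1) + k by ring, Nat.choose_symm_add, show n + 1 + k = n + k + 1 by ring]

/-- `C(n+k+1, k) ≤ C(n+Λ+1, Λ)` for `k ≤ Λ` (monotonicity in the lower index at fixed co-index). [folklore] -/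
theorem choose_shift_mono {n k Λ : ℕ} (hk : k ≤ Λ) : (n + k + 1).choose k ≤ (n + Λ + 1).choose Λ := by
  have h1 : (n + k + 1).choose k = (n + 1 + k).choose (n + 1) := by
    rw [show n + k + 1 = (n + 1) + k by ring, Nat.choose_symm_add]
  have h2 : (n + Λ + 1).choose Λ = (n + 1 + Λ).choose (n + 1) := by
    rw [show n + Λ + 1 = (n + 1) + Λ by ring, Nat.choose_symm_add]
  rw [h1, h2]
  exact Nat.choose_le_choose (n + 1) (by omega)

/-! ### The table functional on one pair monomial of the scalar-block series -/

/-- **The table functional on `F_-[pairPow (b+J) b]`** for real `0 ≤ b ≤ n_b` (`n_b ∈ ℕ`), bounded by the absolute weight: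
`|φ[…]| ≤ (1/2)^{2s} (1/2)^{b+J} (1/2)^b · 2 C(n_b+J+Λ+1, Λ) C(n_b+Λ+1, Λ) · W` when every table index is `≤ Λ`. [folklore] -/
theorem abs_taylorFunctional2D_half_pairPow_le_real (S : Finset (ℕ × ℕ)) (w : ℕ × ℕ → ℝ) {s : ℝ} (hs0 : 0 ≤ s)
    (hs1 : s ≤ 1) {Λ : ℕ} (hΛ : ∀ p ∈ S, p.1 ≤ Λ ∧ p.2 ≤ Λ) {b : ℝ} (hb : 0 ≤ b) {nb : ℕ} (hbn : b ≤ nb) (J : ℕ) :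
    |taylorFunctional2D (1 / 2) S w (crossF s (-1) (pairPow (b + J) b))| ≤
      (1 / 2 : ℝ) ^ s * (1 / 2 : ℝ) ^ s * (1 / 2 : ℝ) ^ (b + J) * (1 / 2 : ℝ) ^ b *
        (2 * (((nb + J + Λ + 1).choose Λ : ℕ) : ℝ) * (((nb + Λ + 1).choose Λ : ℕ) : ℝ) * absWeight S w) := by
  rw [taylorFunctional2D_half_crossF_pairPow S w s hb J, abs_mul]
  have hC0 : 0 ≤ (1 / 2 : ℝ) ^ s * (1 / 2 : ℝ) ^ s * (1 / 2 : ℝ) ^ (b + J) * (1 / 2 : ℝ) ^ b := by positivity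
  rw [abs_of_nonneg hC0]
  refine mul_le_mul_of_nonneg_left ?_ hC0
  refine (Finset.abs_sum_le_sum_abs _ _).trans ?_
  rw [absWeight, Finset.mul_sum]
  refine Finset.sum_le_sum fun p hp => ?_
  obtain ⟨h1, h2⟩ := hΛ p hp
  set A : ℝ := (((nb + J + Λ + 1).choose Λ : ℕ) : ℝ) with hA
  set B : ℝ := (((nb + Λ + 1).choose Λ : ℕ) : ℝ) with hB
  have hbJ0 : 0 ≤ b + J := by positivity
  have hbJn : b + J ≤ ((nb + J : ℕ) : ℝ) := by push_cast; linarith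
  have hqJ : ∀ k : ℕ, k ≤ Λ → |qFactor₁ s (b + J) k| ≤ A := fun k hk =>
    (abs_qFactor₁_le_choose hs0 hs1 hbJ0 hbJn k).trans (by rw [hA]; exact_mod_cast choose_shift_mono hk)
  have hqb : ∀ k : ℕ, k ≤ Λ → |qFactor₁ s b k| ≤ B := fun k hk =>
    (abs_qFactor₁_le_choose hs0 hs1 hb hbn k).trans (by rw [hB]; exact_mod_cast choose_shift_mono hk)
  have hA0 : 0 ≤ A := by rw [hA]; positivity
  have hB0 : 0 ≤ B := by rw [hB]; positivity
  have hbr : |qFactor₁ s (b + J) p.1 * qFactor₁ s b p.2 + qFactor₁ s b p.1 * qFactor₁ s (b + J) p.2| ≤ 2 * A * B := by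
    refine (abs_add_le _ _).trans ?_
    rw [abs_mul, abs_mul, two_mul, add_mul]
    refine add_le_add ?_ ?_
    · exact mul_le_mul (hqJ p.1 h1) (hqb p.2 h2) (abs_nonneg _) hA0
    · exact (mul_le_mul (hqb p.1 h1) (hqJ p.2 h2) (abs_nonneg _) hB0).trans_eq (mul_comm _ _)
  rw [abs_mul, abs_mul, show |(1 - (-1 : ℝ) ^ (p.1 + p.2)) * 2 ^ (p.1 + p.2)| = cfac p from abs_of_nonneg (cfac_nonneg p)]
  calc |w p| * (cfac p * |qFactor₁ s (b + J) p.1 * qFactor₁ s b p.2 + qFactor₁ s b p.1 * qFactor₁ s (b + J) p.2|)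
      ≤ |w p| * (cfac p * (2 * A * B)) :=
        mul_le_mul_of_nonneg_left (mul_le_mul_of_nonneg_left hbr (cfac_nonneg p)) (abs_nonneg _)
    _ = 2 * A * B * (|w p| * cfac p) := by ring

/-! ### The majorant theorem for the scalar block -/

/-- The kept head of the majorant series `Σ_{m<N} 2^{-m} C(m+Λ+2, Λ)`. [folklore] -/
noncomputable def headMajor (Λ N : ℕ) : ℝ := ∑ m ∈ range N, (1 / 2 : ℝ) ^ m * (((m + Λ + 2).choose Λ : ℕ) : ℝ)

/-- **Δ-uniform tail majorant for the scalar block under the table functional at `(1/2,1/2)`** (`0 ≤ s ≤ 1`, table indices `≤ Λ`,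
`0 ≤ Δ ≤ 2`, `Λ < N + 3`): with `σ_N = 4 · tailMajor Λ (N+2)` and `S_N = headMajor Λ N`,
`φ[F_-[g_{Δ,0}]] ≤ φ[F_-[Q_N(Δ,0)]] + (1/2)^{2s} (1/2)^Δ · 2W · σ_N (2 S_N + σ_N)`. PROVED (termwise action of `φ`, `a_m(Δ/2) ≤ 1`,
the pair-monomial bound with `n_b = m'+1`, the product structure of the double series). [cite: RattazziEtAl2008, §5.5] -/
theorem phi_block0_le_QN_add_tail (S : Finset (ℕ × ℕ)) (w : ℕ × ℕ → ℝ) {s : ℝ} (hs0 : 0 ≤ s) (hs1 : s ≤ 1)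
    {Λ : ℕ} (hΛ : ∀ p ∈ S, p.1 ≤ Λ ∧ p.2 ≤ Λ) {Δ : ℝ} (hΔ0 : 0 ≤ Δ) (hΔ2 : Δ ≤ 2) {N : ℕ} (hN : Λ < N + 3) :
    taylorFunctional2D (1 / 2) S w (crossF s (-1) (globalBlock Δ 0)) ≤
      taylorFunctional2D (1 / 2) S w (crossF s (-1) (QN N 0 Δ)) +
        (1 / 2 : ℝ) ^ s * (1 / 2 : ℝ) ^ s * (1 / 2 : ℝ) ^ Δ * (2 * absWeight S w) *
          ((4 * tailMajor Λ (N + 2)) * (2 * headMajor Λ N + 4 * tailMajor Λ (N + 2))) := by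
  have hφ := isTaylorFunctional_taylorFunctional2D (1 / 2) S w
  have hx0 : (0 : ℝ) < 1 / 2 := by norm_num
  have hx1 : (1 / 2 : ℝ) < 1 := by norm_num
  have hΔℓ : ((0 : ℕ) : ℝ) ≤ Δ := by simpa using hΔ0
  have hρ0 : (0 : ℝ) < 1 / 2 * (1 - 1 / 2) / 2 := by norm_num
  have hρ : (1 / 2 : ℝ) * (1 - 1 / 2) / 2 < 1 / 2 * (1 - 1 / 2) := by norm_num
  have hs := hφ.hasSum_mul_of_hasSummableGerms hρ0 (hasSummableGerms_pairPow hΔℓ s hx0 hx1 hρ0 hρ)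
    (crossF s (-1) (globalBlock Δ 0)) (fun h' k hh hk =>
      hasSum_crossF_globalBlock hΔℓ (mem_Ioo_of_abs_lt (hh.trans hρ)) (mem_Ioo_of_abs_lt (hk.trans hρ)))
  have hh : (Δ + ((0 : ℕ) : ℝ)) / 2 = Δ / 2 := by simp
  have hh' : (Δ - ((0 : ℕ) : ℝ)) / 2 = Δ / 2 := by simp
  simp only [hh, hh'] at hs
  -- the family, the majorant family
  set φ' := taylorFunctional2D (1 / 2) S w with hφ'
  set F : ℕ × ℕ → ℝ := fun mm => chiralCoeff (Δ / 2) mm.1 * chiralCoeff (Δ / 2) mm.2 *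
    φ' (crossF s (-1) (pairPow (Δ / 2 + (mm.1 : ℝ)) (Δ / 2 + (mm.2 : ℝ)))) with hF
  have hsF : HasSum F (φ' (crossF s (-1) (globalBlock Δ 0))) := hs
  set C0 : ℝ := (1 / 2 : ℝ) ^ s * (1 / 2 : ℝ) ^ s with hC0
  set K : ℝ := C0 * (1 / 2 : ℝ) ^ Δ * (2 * absWeight S w) with hK
  set t : ℕ → ℝ := fun m => (1 / 2 : ℝ) ^ m * (((m + Λ + 2).choose Λ : ℕ) : ℝ) with ht
  have hC0nn : 0 ≤ C0 := by rw [hC0]; positivity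
  have hDpos : 0 < (1 / 2 : ℝ) ^ Δ := Real.rpow_pos_of_pos (by norm_num) _
  have hKnn : 0 ≤ K := by rw [hK]; have := absWeight_nonneg S w; positivity
  have ht0 : ∀ m, 0 ≤ t m := fun m => by rw [ht]; positivity
  have hh0 : 0 ≤ Δ / 2 := by linarith
  have hh2 : Δ / 2 ≤ 2 := by linarith
  -- (1) termwise bound `F (m,m') ≤ K t_m t_{m'}`
  have hbound : ∀ mm : ℕ × ℕ, F mm ≤ K * (t mm.1 * t mm.2) := by
    intro mm
    obtain ⟨m, m'⟩ := mm
    have ha : 0 ≤ chiralCoeff (Δ / 2) m * chiralCoeff (Δ / 2) m' :=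
      mul_nonneg (chiralCoeff_nonneg hh0 _) (chiralCoeff_nonneg hh0 _)
    have ha1 : chiralCoeff (Δ / 2) m * chiralCoeff (Δ / 2) m' ≤ 1 := by
      calc chiralCoeff (Δ / 2) m * chiralCoeff (Δ / 2) m' ≤ 1 * 1 :=
            mul_le_mul (chiralCoeff_le_one hh0 hh2 _) (chiralCoeff_le_one hh0 hh2 _) (chiralCoeff_nonneg hh0 _) zero_le_one
        _ = 1 := one_mul _
    -- the pair monomial in the form `pairPow (b + J) b`, `b = Δ/2 + min`, `J = |m - m'|`
    have hval : |φ' (crossF s (-1) (pairPow (Δ / 2 + (m : ℝ)) (Δ / 2 + (m' : ℝ))))| ≤ K / 2 * (t m * t m') * 2 := by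
      rcases le_total m' m with hle | hle
      · obtain ⟨J, rfl⟩ := Nat.exists_eq_add_of_le hle
        have hb : 0 ≤ Δ / 2 + (m' : ℝ) := by positivity
        have hbn : Δ / 2 + (m' : ℝ) ≤ ((m' + 1 : ℕ) : ℝ) := by push_cast; linarith
        have hv := abs_taylorFunctional2D_half_pairPow_le_real S w hs0 hs1 hΛ hb hbn J
        have e1 : Δ / 2 + (m' : ℝ) + (J : ℝ) = Δ / 2 + ((m' + J : ℕ) : ℝ) := by push_cast; ring
        rw [e1] at hv
        refine hv.trans (le_of_eq ?_)
        have e2 : (1 / 2 : ℝ) ^ (Δ / 2 + ((m' + J : ℕ) : ℝ)) * (1 / 2 : ℝ) ^ (Δ / 2 + (m' : ℝ)) =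
            (1 / 2 : ℝ) ^ Δ * ((1 / 2 : ℝ) ^ (m' + J) * (1 / 2 : ℝ) ^ m') := by
          rw [Real.rpow_add_natCast (by norm_num), Real.rpow_add_natCast (by norm_num), ← Real.rpow_natCast,
            ← Real.rpow_natCast]
          have : (1 / 2 : ℝ) ^ Δ = (1 / 2 : ℝ) ^ (Δ / 2) * (1 / 2 : ℝ) ^ (Δ / 2) := by
            rw [← Real.rpow_add (by norm_num)]; ring_nf
          rw [this]; ring
        rw [hK, hC0, ht]
        simp only
        rw [show m' + 1 + J + Λ + 1 = m' + J + Λ + 2 by ring, show m' + 1 + Λ + 1 = m' + Λ + 2 by ring]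
        calc (1 / 2 : ℝ) ^ s * (1 / 2 : ℝ) ^ s * (1 / 2 : ℝ) ^ (Δ / 2 + ((m' + J : ℕ) : ℝ)) * (1 / 2 : ℝ) ^ (Δ / 2 + (m' : ℝ)) *
              (2 * (((m' + J + Λ + 2).choose Λ : ℕ) : ℝ) * (((m' + Λ + 2).choose Λ : ℕ) : ℝ) * absWeight S w)
            = (1 / 2 : ℝ) ^ s * (1 / 2 : ℝ) ^ s * ((1 / 2 : ℝ) ^ (Δ / 2 + ((m' + J : ℕ) : ℝ)) * (1 / 2 : ℝ) ^ (Δ / 2 + (m' : ℝ))) *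
              (2 * (((m' + J + Λ + 2).choose Λ : ℕ) : ℝ) * (((m' + Λ + 2).choose Λ : ℕ) : ℝ) * absWeight S w) := by ring
          _ = _ := by rw [e2]; ring
      · obtain ⟨J, rfl⟩ := Nat.exists_eq_add_of_le hle
        have hb : 0 ≤ Δ / 2 + (m : ℝ) := by positivity
        have hbn : Δ / 2 + (m : ℝ) ≤ ((m + 1 : ℕ) : ℝ) := by push_cast; linarith
        have hv := abs_taylorFunctional2D_half_pairPow_le_real S w hs0 hs1 hΛ hb hbn J
        have e1 : Δ / 2 + (m : ℝ) + (J : ℝ) = Δ / 2 + ((m + J : ℕ) : ℝ) := by push_cast; ring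
        rw [e1] at hv
        rw [show pairPow (Δ / 2 + (m : ℝ)) (Δ / 2 + ((m + J : ℕ) : ℝ)) = pairPow (Δ / 2 + ((m + J : ℕ) : ℝ)) (Δ / 2 + (m : ℝ)) from
          funext fun z => funext fun zb => pairPow_comm _ _ z zb]
        refine hv.trans (le_of_eq ?_)
        have e2 : (1 / 2 : ℝ) ^ (Δ / 2 + ((m + J : ℕ) : ℝ)) * (1 / 2 : ℝ) ^ (Δ / 2 + (m : ℝ)) =
            (1 / 2 : ℝ) ^ Δ * ((1 / 2 : ℝ) ^ (m + J) * (1 / 2 : ℝ) ^ m) := by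
          rw [Real.rpow_add_natCast (by norm_num), Real.rpow_add_natCast (by norm_num), ← Real.rpow_natCast,
            ← Real.rpow_natCast]
          have : (1 / 2 : ℝ) ^ Δ = (1 / 2 : ℝ) ^ (Δ / 2) * (1 / 2 : ℝ) ^ (Δ / 2) := by
            rw [← Real.rpow_add (by norm_num)]; ring_nf
          rw [this]; ring
        rw [hK, hC0, ht]
        simp only
        rw [show m + 1 + J + Λ + 1 = m + J + Λ + 2 by ring, show m + 1 + Λ + 1 = m + Λ + 2 by ring]
        calc (1 / 2 : ℝ) ^ s * (1 / 2 : ℝ) ^ s * (1 / 2 : ℝ) ^ (Δ / 2 + ((m + J : ℕ) : ℝ)) * (1 / 2 : ℝ) ^ (Δ / 2 + (m : ℝ)) *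
              (2 * (((m + J + Λ + 2).choose Λ : ℕ) : ℝ) * (((m + Λ + 2).choose Λ : ℕ) : ℝ) * absWeight S w)
            = (1 / 2 : ℝ) ^ s * (1 / 2 : ℝ) ^ s * ((1 / 2 : ℝ) ^ (Δ / 2 + ((m + J : ℕ) : ℝ)) * (1 / 2 : ℝ) ^ (Δ / 2 + (m : ℝ))) *
              (2 * (((m + J + Λ + 2).choose Λ : ℕ) : ℝ) * (((m + Λ + 2).choose Λ : ℕ) : ℝ) * absWeight S w) := by ring
          _ = _ := by rw [e2]; ring
    have hKt : 0 ≤ K / 2 * (t m * t m') * 2 := by have := ht0 m; have := ht0 m'; positivity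
    calc F (m, m') = chiralCoeff (Δ / 2) m * chiralCoeff (Δ / 2) m' *
          φ' (crossF s (-1) (pairPow (Δ / 2 + (m : ℝ)) (Δ / 2 + (m' : ℝ)))) := by simp only [hF]
      _ ≤ chiralCoeff (Δ / 2) m * chiralCoeff (Δ / 2) m' * (K / 2 * (t m * t m') * 2) :=
          mul_le_mul_of_nonneg_left ((le_abs_self _).trans hval) ha
      _ ≤ 1 * (K / 2 * (t m * t m') * 2) := mul_le_mul_of_nonneg_right ha1 hKt
      _ = K * (t m * t m') := by ring
  -- (2) the majorant family is summable with sum `K S²`, `S = Σ t`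
  obtain ⟨hts, htail⟩ := tsum_tail_le_tailMajor (Λ := Λ) (M := N + 2) (by omega)
  have hshift : ∀ j : ℕ, t (j + N) = 4 * ((1 / 2 : ℝ) ^ (j + (N + 2)) * ((j + (N + 2) + Λ).choose Λ : ℝ)) := by
    intro j
    rw [ht]
    simp only
    rw [show j + (N + 2) = (j + N) + 2 by ring, pow_add, show j + N + 2 + Λ = j + N + Λ + 2 by ring]
    norm_num
    ring
  have htN : Summable fun j : ℕ => t (j + N) := by
    have := hts.mul_left 4
    refine this.congr fun j => ?_
    rw [hshift]
  have htsum : Summable t := (summable_nat_add_iff N).mp htN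
  set Ssum : ℝ := ∑' m, t m with hS
  have hSN : Ssum = headMajor Λ N + ∑' j, t (j + N) := by
    rw [hS, headMajor, ← Summable.sum_add_tsum_nat_add N htsum]
  have hTle : ∑' j, t (j + N) ≤ 4 * tailMajor Λ (N + 2) := by
    calc ∑' j, t (j + N) = ∑' j, 4 * ((1 / 2 : ℝ) ^ (j + (N + 2)) * ((j + (N + 2) + Λ).choose Λ : ℝ)) :=
          tsum_congr hshift
      _ = 4 * ∑' j, (1 / 2 : ℝ) ^ (j + (N + 2)) * ((j + (N + 2) + Λ).choose Λ : ℝ) := tsum_mul_left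
      _ ≤ 4 * tailMajor Λ (N + 2) := by linarith [htail]
  have hT0 : 0 ≤ ∑' j, t (j + N) := tsum_nonneg fun j => ht0 _
  have hH0 : 0 ≤ headMajor Λ N := Finset.sum_nonneg fun m _ => ht0 m
  have hGs : Summable fun mm : ℕ × ℕ => K * (t mm.1 * t mm.2) :=
    (htsum.mul_of_nonneg htsum ht0 ht0).mul_left K
  have hG : HasSum (fun mm : ℕ × ℕ => K * (t mm.1 * t mm.2)) (K * (Ssum * Ssum)) := by
    have h1 := htsum.hasSum.mul htsum.hasSum (htsum.mul_of_nonneg htsum ht0 ht0)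
    exact h1.mul_left K
  -- (3) kept square = `φ[Q_N]` for `F`, `K S_N²` for the majorant
  set R : Finset (ℕ × ℕ) := range N ×ˢ range N with hR
  have hQ : ∑ mm ∈ R, F mm = φ' (crossF s (-1) (QN N 0 Δ)) := by
    have hT := TN_eq_phi_QN φ' s N 0 Δ
    simp only [hh, hh'] at hT
    rw [← hT, hR, Finset.sum_product]
  have hRG : ∑ mm ∈ R, K * (t mm.1 * t mm.2) = K * (headMajor Λ N * headMajor Λ N) := by
    rw [hR, ← Finset.mul_sum, Finset.sum_product, headMajor, Finset.sum_mul_sum]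
  -- (4) compare the complements
  have hFc : HasSum (fun x : {x // x ∉ R} => F x) (φ' (crossF s (-1) (globalBlock Δ 0)) - ∑ mm ∈ R, F mm) :=
    (Finset.hasSum_iff_compl R).mp hsF
  have hGc : HasSum (fun x : {x // x ∉ R} => K * (t x.1.1 * t x.1.2))
      (K * (Ssum * Ssum) - ∑ mm ∈ R, K * (t mm.1 * t mm.2)) :=
    (Finset.hasSum_iff_compl R).mp hG
  have hcmp := hasSum_le (fun x : {x // x ∉ R} => hbound x.1) hFc hGc
  rw [hQ, hRG] at hcmp
  -- (5) `S² - S_N² ≤ σ(2 S_N + σ)`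
  have hsq : Ssum * Ssum - headMajor Λ N * headMajor Λ N ≤
      (4 * tailMajor Λ (N + 2)) * (2 * headMajor Λ N + 4 * tailMajor Λ (N + 2)) := by
    rw [hSN]
    nlinarith [hTle, hT0, hH0]
  have hfin : K * (Ssum * Ssum) - K * (headMajor Λ N * headMajor Λ N) ≤
      K * ((4 * tailMajor Λ (N + 2)) * (2 * headMajor Λ N + 4 * tailMajor Λ (N + 2))) := by
    rw [← mul_sub]; exact mul_le_mul_of_nonneg_left hsq hKnn
  have : φ' (crossF s (-1) (globalBlock Δ 0)) - φ' (crossF s (-1) (QN N 0 Δ)) ≤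
      K * ((4 * tailMajor Λ (N + 2)) * (2 * headMajor Λ N + 4 * tailMajor Λ (N + 2))) := hcmp.trans hfin
  rw [hK, hC0] at this
  linarith

end Summit.CriticalPhenomena.Ising3D.Control2D
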